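import Summits.ABC.IUTFork.Cor312ProvenancePoint
import Summits.ABC.IUTFork.Cor312ProvenanceGenuine
import Summits.ABC.IUTFork.LDHGenuine
import Literature.IUT.LogVolume.GenuineLogThetaPoint
import HarnessLib

/-!
# The fork at [IUTchIII] Corollary 3.12, L-DH level: `−|log(q)|` of a genuine Θ-volume datum IS `−(1/2l)·log(q)`
# of the initial Θ-data, hence `−(1/2l)·log(q^{∤{2,l}}(λ))` of the point (route D3, part f: the `q`-side dictionary)

Record-only file (D-0012) of the abc-iut cell (campaign-S seat abc-iut-S2); TAKES NO SIDE. [IUTchIV] Thm. 1.10 (kurims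
Apr-2020 manuscript p. 23 l. 19–30): "`log(q) := deg(𝔮^{F□}_{ADiv}) ∈ ℝ_{≥0}` … independent of the choice of `F□`",
"the quantity “`|log(q)|`” … is equal to `(1/2l)·log(q)`"; Cor. 2.2 (ii) proof (p. 46 l. 1): for the Θ-data of (P5),
`log(q) = log(q^{∤{2,l}})` of the Legendre curve of `λ`. Dupuy–Hilado §3.3: `P_q := Σ_{v∈S} ord_v(q̲_v)[v]`,
`q̲_v = q_v^{1/2l}`, over `ℚ(j_E)`.

The `q`-side dictionary — the Literature-level `−|log(q)|` of a genuine Θ-volume input (abc-iut-S2's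
`ThetaVolumeInput.negAbsLogQ = −deĝ̲(P_q)` over `F_mod`) IS `−(1/2l)·log(q)` of the initial Θ-data and, on the `λ`-line
with the (P5) choice, `−(1/2l)·log(q^{∤{2,l}}(λ))` — was proved summit-side by abc-iut-c312-8
(`Cor312ProvenanceGenuine`: `ndeg_qDivisor_pilotData_eq_logq`, `negAbsLogQ_eq_neg_absLogq_of_isVolumeInputOf`;
`Cor312ProvenancePointJ.logq_eq_logQAvoid_of_j_extend`, any model `E_F` with `j(E_F) = j(λ)`). THIS FILE reads it on
abc-iut-S2's bundled datum (v2, re-based 2026-08-26: generic curve with `j_eq`)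
`Cor22.ThetaVolumeDatumAt P l` and COMBINES it with the D3 chain:
* `PointDict.negAbsLogQ_eq : T.negAbsLogQ = −(1/2l)·Cor22.logQAvoid P {2,l}` and
  `cor312Of_iff_logQAvoid : T.Cor312Of ↔ −(1/2l)·log(q^{∤{2,l}}(λ)) ≤ −|log(Θ)|(T)` — the route-level
  `Cor22.Cor312AtDatum P l` in print's currency, datum by datum;
* `gap_pilotData_eq`, `gap_eq : T.gap = ((l+1)/24 − 1/(2l))·Cor22.logQAvoid P {2,l}` (c312-3's
  `degLgp_thetaPilot_sub_deg_qPilot` normalised + the dictionary);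
* `logQAvoid_le_of_cor312AtDatum : Cor312AtDatum P l → HullVolumeAtDatum P l δ → ∀ T,
  ((l+1)/24 − 1/(2l))·log(q^{∤{2,l}}(λ)) ≤ δ + ((l+5)/4)·log π`;
[cite: Mochizuki2012, IUTchIV Thm. 1.10 p. 23] [cite: Mochizuki2012, IUTchIV Cor. 2.2 (ii) proof p. 46]
[cite: DupuyHilado2025, §3.3] [claim: Mochizuki2012, status: disputed] for every IUT quotation. Nothing asserted about
any curve; no side taken on Cor. 3.12.
-/

noncomputable section

namespace Summit.ABC.IUTFork

open Literature.IUT.HodgeTheaters Literature.IUT.LogVolume NumberField IsDedekindDomain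
open Literature.NumberTheory.DiophantineGeometry.GenEll

/-! ## At the `λ`-line: `−|log(q)|(T) = −(1/2l)·log(q^{∤{2,l}}(λ))` -/

namespace PointDict

variable {P : NFPoint} {l : ℕ}

/-- **For every genuine Θ-volume datum `T` at `(P, l)` with `λ ∈ U_X`: `−|log(q)|(T) = −(1/2l)·log(q^{∤{2,l}}(λ))`**
(abc-iut-S-d2's `Cor22.logQAvoid P {2, l}`; c312-8's `Cor312Prov.logq_eq_logQAvoid_of_j_extend` under the (P5) choice, from the
datum's `j_eq`; the hypothesis `λ ∈ U_X` is kept in the signature but no longer used).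
Hence the route-level `Cor22.Cor312AtDatum P l` says, datum by datum, `−(1/2l)·log(q^{∤{2,l}}(λ)) ≤ −|log(Θ)|(T)`.
[cite: Mochizuki2012, IUTchIV Cor. 2.2 (ii) proof p. 46] -/
theorem negAbsLogQ_eq (T : Cor22.ThetaVolumeDatumAt P l) (hU : P.InU) :
    T.negAbsLogQ = -(1 / (2 * (l : ℝ))) * Cor22.logQAvoid P {2, l} := by
  letI := T.instFieldF; letI := T.instNumberFieldF; letI := T.instAlgebraF; letI := T.instFieldK
  letI := T.instNumberFieldK; letI := T.instAlgebraK; letI := T.instFieldFbar; letI := T.instAlgebraFbar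
  letI := T.instAlgebraKFbar; letI := T.instIsElliptic
  have h1 : T.negAbsLogQ = -Cor312Prov.absLogq T.D :=
    Cor312Prov.negAbsLogQ_eq_neg_absLogq_of_isVolumeInputOf T.D T.isVolumeInputOf
  -- `hU` is retained for the append-only signature; since v2 of the datum (`T.j_eq`) it is not needed.
  have _ := hU
  rw [h1, Cor312Prov.absLogq, Cor312Prov.logq_eq_logQAvoid_of_j_extend T.j_eq T.D T.isP5Choice]
  ring

/-- The datum-level Cor. 3.12 unfolded at the point: `T.Cor312Of ↔ −(1/2l)·log(q^{∤{2,l}}(λ)) ≤ −|log(Θ)|(T)`.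
HYPOTHESIS form; nothing asserted. [claim: Mochizuki2012, status: disputed] -/
theorem cor312Of_iff_logQAvoid (T : Cor22.ThetaVolumeDatumAt P l) (hU : P.InU) :
    T.Cor312Of ↔ -(1 / (2 * (l : ℝ))) * Cor22.logQAvoid P {2, l} ≤ T.negLogTheta := by
  rw [T.cor312Of_iff, negAbsLogQ_eq T hU]

/-- The normalised gap of the pilot divisors of `D`'s pilot data in closed form:
`deĝ̲_lgp(P_Θ) − deĝ̲(P_q) = ((l+1)/24 − 1/(2l))·log(q)` (c312-3's `degLgp_thetaPilot_sub_deg_qPilot` divided by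
`[F_mod : ℚ]`, with `deĝ̲(𝔮) = log(q)` of the datum). [cite: DupuyHilado2025, §3.3] -/
theorem gap_pilotData_eq {F K Fbar : Type} [Field F] [NumberField F] [Field K] [NumberField K] [Algebra F K]
    [Field Fbar] [Algebra F Fbar] [Algebra K Fbar] {E : WeierstrassCurve F} [E.IsElliptic] {l : ℕ}
    {Pb : BadPlacePredicates K} (D : InitialThetaData F K Fbar E l Pb) :
    LgpDivisor.ndegLgp (ThetaData.pilotData D).thetaPilot -
        FinDivisor.ndeg (fieldOfModuli E) (ThetaData.pilotData D).qPilot =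
      (((l : ℝ) + 1) / 24 - 1 / (2 * l)) * Cor312Prov.logq D := by
  rw [← Cor312Prov.ndeg_qDivisor_pilotData_eq_logq D, LgpDivisor.ndegLgp_eq, FinDivisor.ndeg_apply, FinDivisor.ndeg_apply,
    ← sub_div, PilotData.degLgp_thetaPilot_sub_deg_qPilot, ThetaData.pilotData_l, mul_div_assoc]

/-- **The gap at the point in closed form**: for a genuine datum `T` at `(P, l)` with `λ ∈ U_X`,
`deĝ̲_lgp(P_Θ) − deĝ̲(P_q) = ((l+1)/24 − 1/(2l))·log(q^{∤{2,l}}(λ))` — the left-hand side of [IUTchIV] Thm. 1.10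
Step (viii)'s display before the substitutions. [cite: Mochizuki2012, IUTchIV Thm. 1.10 Step (viii) p. 30] -/
theorem gap_eq (T : Cor22.ThetaVolumeDatumAt P l) (hU : P.InU) :
    T.gap = (((l : ℝ) + 1) / 24 - 1 / (2 * l)) * Cor22.logQAvoid P {2, l} := by
  letI := T.instFieldF; letI := T.instNumberFieldF; letI := T.instAlgebraF; letI := T.instFieldK
  letI := T.instNumberFieldK; letI := T.instAlgebraK; letI := T.instFieldFbar; letI := T.instAlgebraFbar
  letI := T.instAlgebraKFbar; letI := T.instIsElliptic
  show LgpDivisor.ndegLgp T.I.X.thetaPilot - FinDivisor.ndeg _ T.I.X.qPilot = _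
  -- `hU` is retained for the append-only signature; since v2 of the datum (`T.j_eq`) it is not needed.
  have _ := hU
  rw [T.isVolumeInputOf.X_eq, gap_pilotData_eq T.D, Cor312Prov.logq_eq_logQAvoid_of_j_extend T.j_eq T.D T.isP5Choice]

/-- **THE SQUEEZE AT THE POINT, IN PRINT'S CURRENCY**: IF [IUTchIII] Cor. 3.12 holds at the Θ-data of `(P, l)`
(`Cor22.Cor312AtDatum P l`, HYPOTHESIS — disputed) AND the computable half holds with `δ` (`Cor22.HullVolumeAtDatum P
l δ`, to be proved), THEN for any genuine datum at `(P, l)` (`λ ∈ U_X`):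
`((l+1)/24 − 1/(2l))·log(q^{∤{2,l}}(λ)) ≤ δ + ((l+5)/4)·log π` — the inequality which [IUTchIV] Thm. 1.10 Steps
(viii)–(x) (pp. 30–32) rearrange into `Cor22.Display P l η` once `δ` is the explicit Step (v)/(vi) constant. Pure
bookkeeping of the two `Prop`s and the dictionary; nothing asserted. [claim: Mochizuki2012, status: disputed] -/
theorem logQAvoid_le_of_cor312AtDatum {δ : ℝ} (h1 : Cor22.Cor312AtDatum P l) (h2 : Cor22.HullVolumeAtDatum P l δ)
    (T : Cor22.ThetaVolumeDatumAt P l) (hU : P.InU) :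
    (((l : ℝ) + 1) / 24 - 1 / (2 * l)) * Cor22.logQAvoid P {2, l} ≤ δ + ThetaVolumeInput.archLogTheta l := by
  rw [← gap_eq T hU]
  exact Cor22.gap_le_at h1 h2 T

/-- **The computable half HOLDS at every genuine datum of `(P, l)`** with abc-iut-c312-d1's explicit constant
`δΣ(T) = DHData.explicitDelta T.I` (abc-iut-S2's `hullEstimateOf_ofInput`; nothing assumed).
[cite: Mochizuki2012, IUTchIV Thm. 1.10 Steps (iv)–(viii) p. 26–30] -/
theorem hullEstimateOf_at (T : Cor22.ThetaVolumeDatumAt P l) :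
    T.HullEstimateOf
      (letI := T.instFieldF; letI := T.instNumberFieldF; letI := T.instFieldK; letI := T.instNumberFieldK
       letI := T.instAlgebraK
       DHData.explicitDelta T.I) := by
  letI := T.instFieldF; letI := T.instNumberFieldF; letI := T.instFieldK; letI := T.instNumberFieldK
  letI := T.instAlgebraK
  exact DHData.hullEstimateOf_ofInput T.I

/-- **THE SQUEEZE AT THE POINT MODULO [IUTchIII] Cor. 3.12 ALONE**: `Cor22.Cor312AtDatum P l` (HYPOTHESIS —
disputed) implies, for every genuine datum `T` at `(P, l)` with `λ ∈ U_X`,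
`((l+1)/24 − 1/(2l))·log(q^{∤{2,l}}(λ)) ≤ δΣ(T) + ((l+5)/4)·log π` with the EXPLICIT, kernel-computed `δΣ(T)` —
the computable half being a theorem (`hullEstimateOf_at`). What remains between this and `Cor22.Display P l η` is
the arithmetic of [IUTchIV] Thm. 1.10 Steps (v)–(x) bounding `δΣ(T)` by the printed `log-diff + log-cond` terms
(campaign S: abc-iut-S3's `theorem110`, abc-iut-L5-t15's different bounds). [claim: Mochizuki2012, status: disputed] -/
theorem logQAvoid_le_of_cor312AtDatum_explicit (h1 : Cor22.Cor312AtDatum P l) (T : Cor22.ThetaVolumeDatumAt P l)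
    (hU : P.InU) :
    (((l : ℝ) + 1) / 24 - 1 / (2 * l)) * Cor22.logQAvoid P {2, l} ≤
      (letI := T.instFieldF; letI := T.instNumberFieldF; letI := T.instFieldK; letI := T.instNumberFieldK
       letI := T.instAlgebraK
       DHData.explicitDelta T.I) + ThetaVolumeInput.archLogTheta l := by
  rw [← gap_eq T hU]
  exact T.gap_le (h1 T) (hullEstimateOf_at T)

end PointDict

end Summit.ABC.IUTFork

end
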